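import Literature.Computability.AlgebraicComplexity.BI17Ex56KroneckerEightFive
import Literature.Computability.AlgebraicComplexity.BI17MinimalDegreeTableExtension
import HarnessLib

/-!
# `e(17) = 85` and `e(83) = 830` from `k_8(5) > 0` (BI 2017 Problem 5.19; theorem-only)

Two more entries of the table of minimal degrees `e(m)` of generic `m × m × m` tensor invariants
(P. Bürgisser, C. Ikenmeyer, J. Algebra 477 (2017) §5, Problem 5.19 [BurgisserIkenmeyer2017]) that
follow from the `S_40` class-sum certificate `k_8(5) = 9854 > 0` (`kronRect_eight_five_pos`, val-lit
t10, `BI17Ex56KroneckerEightFive.lean`) by the near-square principle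
(`genericTensorMinimalDegree_sq_sub_eq`, complement symmetry `k_j(δ) = k_{δ²−j}(δ)`):

* `e(17) = 85` (`δ = 5`: `k_17(5) = k_8(5) > 0`; the window `17 ≤ m ≤ 25` is now complete but for the
  odd anomaly `e(23) ∈ {138} ∪ [161, ∞)`, `= 138 ⇔ k_13(6) > 0`);
* `e(83) = 830` (`δ = 10`: `k_17(10) = k_17(5 + 5) > 0`).

(t10's assembly file also carries
`kronRect_eight_pos_of_three_le` and `BI2017_ex_5_6_of_six_atoms`.) Honest framing (cell `val-lit`, row BI2017-B): bookkeeping; VP ≠ VNP is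
NOT proved. No definitions, no named facts.
-/

noncomputable section

namespace Literature.Computability.AlgebraicComplexity

/-- `k_17(5) > 0` (`= k_8(5)`, `8 + 17 = 5²`). [cite: BurgisserIkenmeyer2017, §5 eq. (5.2)] -/
theorem kronRect_seventeen_five_pos : 0 < kronRect ℂ 17 5 :=
  kronRect_sq_sub_pos (δ := 5) (j := 8) (by norm_num) kronRect_eight_five_pos

/-- **`e(17) = 85`** (`δ = 5`, `k_8(5) > 0`). [cite: BurgisserIkenmeyer2017, Ex. 5.6 and Problem 5.19] -/
theorem genericTensorMinimalDegree_seventeen : genericTensorMinimalDegree (Fin 17) ℂ = 85 :=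
  genericTensorMinimalDegree_sq_sub_eq (δ := 5) (j := 8) (by norm_num) kronRect_eight_five_pos

/-- `k_17(10) > 0` (`= k_17(5 + 5)`). [cite: BurgisserIkenmeyer2017, Rem. 5.18] -/
theorem kronRect_seventeen_ten_pos : 0 < kronRect ℂ 17 10 :=
  kronRect_add_pos (δ₁ := 5) (δ₂ := 5) (by norm_num) kronRect_seventeen_five_pos kronRect_seventeen_five_pos

/-- **`e(83) = 830`** (`δ = 10`, `k_17(10) > 0`). [cite: BurgisserIkenmeyer2017, Problem 5.19] -/
theorem genericTensorMinimalDegree_eightyThree : genericTensorMinimalDegree (Fin 83) ℂ = 830 :=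
  genericTensorMinimalDegree_sq_sub_eq (δ := 10) (j := 17) (by norm_num) kronRect_seventeen_ten_pos

/-- The window `17 ≤ m ≤ 25` but for `e(23)`: `e(17) = 85`, `e(18) = 90`, `e(19) = 95`, `e(20) = 100`,
`e(21) = 105`, `e(22) = 110`, `e(24) = 120`, `e(25) = 125`, and `138 ≤ e(23)`.
[cite: BurgisserIkenmeyer2017, Ex. 5.6 and Problem 5.19] -/
theorem genericTensorMinimalDegree_seventeen_to_twentyFive :
    genericTensorMinimalDegree (Fin 17) ℂ = 85 ∧ genericTensorMinimalDegree (Fin 18) ℂ = 90 ∧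
    genericTensorMinimalDegree (Fin 19) ℂ = 95 ∧ genericTensorMinimalDegree (Fin 20) ℂ = 100 ∧
    genericTensorMinimalDegree (Fin 21) ℂ = 105 ∧ genericTensorMinimalDegree (Fin 22) ℂ = 110 ∧
    genericTensorMinimalDegree (Fin 24) ℂ = 120 ∧ genericTensorMinimalDegree (Fin 25) ℂ = 125 ∧
    138 ≤ genericTensorMinimalDegree (Fin 23) ℂ :=
  ⟨genericTensorMinimalDegree_seventeen, genericTensorMinimalDegree_eighteen,
    genericTensorMinimalDegree_delta_five⟩

end Literature.Computability.AlgebraicComplexity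

end
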